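import Literature.Probability.LatticeModels.NVectorInfraredBoundProofs
import HarnessLib

/-!
# Gaussian domination for `ν`-vector models with DIRECTION-DEPENDENT nearest-neighbour couplings
# on the even torus (Fröhlich–Israel–Lieb–Simon 1978, Thm. 4.6–4.7; Friedli–Velenik 2017, Prop. 10.27)

Topic `Probability/LatticeModels`, namespace `Literature.Probability.LatticeModels.NVector`.
Companion of the tree's isotropic engine `NVectorInfraredBoundProofs.lean` (Friedli–Velenik 2017,
§10.5.3: Gaussian domination `Z(h) ≤ Z(0)` for the `ν`-component models (10.38) with ONE coupling
`β` on every bond of `(ℤ/Lℤ)^d`). Here the bond form carries a WEIGHT per edge,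
`𝓔_W(f,g) = ∑_{{x,y} ∈ E} W_{x,y} (f_x - f_y)·(g_x - g_y)` (`wvecGradForm`), and the functional is
`Z_W(h) = ∫ exp{-𝓔_W(ω + h, ω + h)} dμ₀(ω)`, `μ₀ = ⊗_{x} ρ` (`wvZ`; the inverse temperature is
absorbed in `W`). The case of record is the torus `(ℤ/Lℤ)^d` with direction-dependent couplings
`W_{x,x+eᵢ} = K_i ≥ 0` (`bondWeight K`): the ANISOTROPIC nearest-neighbour `ν`-vector model of
Fröhlich–Israel–Lieb–Simon 1978, §3–§4 (reflection positivity through the planes perpendicular to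
axis `i` involves only the direction-`i` bonds, all with the same coupling `K_i`; Thm. 4.6–4.7:
"the Gaussian domination estimate `Z(h_α) ≤ Z(0)` holds for arbitrary `dρ` and, in particular,
`g_Λ(p) ≤ (2βE_p)⁻¹`" with `E_p` "depending on `J_{αγ}`"), whose layered instance
`K = (J∥, J∥, J⊥)` is the comparison model of the `hubbard-tc` cell's interlayer grammar and of
`AnisotropicPlaneRotatorLRO.lean` (where this anisotropic Gaussian-domination step is recorded as
`TODO(general form)`).

PROVED here (no named fact), following the printed proof of Friedli–Velenik's Prop. 10.27 exactly
as the isotropic tree file does, with the weight threaded through: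

1. `wexponent_split`, `wvZ_eq_wpairInt` — for a reflection `θ` of a finite graph with positive half
   `P` under which `W` is invariant and CONSTANT `= c` on the crossing bonds `{x, θx}`, the exponent
   splits as `A_g(ω|_P) + A_{g∘θ}((ω∘θ)|_P) + 2c∑_{x crossing}(ω_x + g_x)·(ω_{θx} + g_{θx})`
   (`whalfExp`), and `Z_W(g)` is the two-half integral `wpairInt(g, g∘θ)`;
2. `wpairInt_sq_le`, **`wvZ_sq_le_reflect`** — Lemma 10.28 (the tree's integral Cauchy–Schwarz
   `kerInt_sq_le` with parameter `2c ≥ 0`) gives `Z_W(h)² ≤ Z_W(h⁺) Z_W(h⁻)`;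
3. **`wvZ_le_wvZ_zero`** — on `(ℤ/Lℤ)^d`, `L` even, `L ≥ 4`, with `K_i ≥ 0`:
   `Z_K(h) ≤ Z_K(0)` for every field `h`, by the printed descent on the number of bad bonds
   (the reflection between sites perpendicular to axis `i` preserves `bondWeight K`,
   `bondWeight_map_reflectBetweenSites`, and its crossing bonds are direction-`i` bonds,
   `bondWeight_cross`; the bad-bond bookkeeping `vbadBonds_reflPlus_add_reflMinus` and the finite
   Kennedy–Lieb–Shastry descent are the tree's).

Not here (next file `NVectorAnisotropicInfraredBound.lean`): the second-order consequence, the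
plane waves with the anisotropic dispersion `E_K(p) = ∑ᵢ K_i(1 - cos pᵢ)` and the infrared /
long-range-order bounds.

## References

* J. Fröhlich, R. Israel, E. H. Lieb, B. Simon, *Phase transitions and reflection positivity. I.
  General theory and long range lattice models*, Comm. Math. Phys. 62 (1978) 1–34, §3 and §4,
  (4.6)–(4.10), Thms. 4.6–4.7 (Lieb, *Statistical Mechanics* (Selecta), pp. 211–212, read)
  [FILS1978].
* S. Friedli, Y. Velenik, *Statistical Mechanics of Lattice Systems*, CUP (2017), §10.5.3,
  Prop. 10.27, Lemma 10.28 and the proof of Prop. 10.27 (pp. 503–505, read) [FriedliVelenik2017].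
* T. Kennedy, E. H. Lieb, B. S. Shastry, J. Stat. Phys. 53 (1988) 1019–1030, p. 1029 (finite
  descent) and eq. (7) (the layered dispersion `E^r_q`) [KLS1988JSP].
-/

noncomputable section

open MeasureTheory Filter Topology Finset
open scoped Real

namespace Literature.Probability.LatticeModels

namespace NVector

/-! ### Weighted bond forms of vector fields and the functional `Z_W(h)` -/

section WeightedForms

variable {V : Type*} [Fintype V] (G : SimpleGraph V) [DecidableRel G.Adj] {ν : ℕ}
  (W : Sym2 V → ℝ)

/-- The WEIGHTED bond form of `ν`-component fields,
`𝓔_W(f,g) = ∑_{{x,y} ∈ E} W_{x,y} (f_x - f_y)·(g_x - g_y)`; for `W ≡ β` this is `β` times the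
tree's `vecGradForm` (Friedli–Velenik 2017, (10.47)); for the torus with `W_{x,x+eᵢ} = K_i` it is the
quadratic form of the anisotropic Hamiltonian of Fröhlich–Israel–Lieb–Simon 1978, §4.
[cite: FILS1978, §4, Thm. 4.6 (the form `H = ½∑ J_{αγ}(σ_α - σ_γ)²`)] -/
def wvecGradForm (f g : V → Fin ν → ℝ) : ℝ :=
  ∑ e ∈ G.edgeFinset, W e * Sym2.lift ⟨fun x y => ∑ a, (f x a - f y a) * (g x a - g y a),
    fun x y => Finset.sum_congr rfl fun a _ => by ring⟩ e

variable {G W}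

/-- Expansion of the weighted quadratic form along a line:
`𝓔_W(s + t h) = 𝓔_W(s) + 2t 𝓔_W(s,h) + t² 𝓔_W(h)`. [cite: FriedliVelenik2017, §10.5.3, proof of Thm. 10.24 (elementary computations) and eq. (10.47)] -/
theorem wvecGradForm_add_smul_self (s h : V → Fin ν → ℝ) (t : ℝ) :
    wvecGradForm G W (s + t • h) (s + t • h) =
      wvecGradForm G W s s + 2 * t * wvecGradForm G W s h + t ^ 2 * wvecGradForm G W h h := by
  unfold wvecGradForm
  rw [Finset.mul_sum, Finset.mul_sum, ← Finset.sum_add_distrib, ← Finset.sum_add_distrib]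
  refine Finset.sum_congr rfl fun e _ => ?_
  induction e using Sym2.ind with
  | _ x y =>
    simp only [Sym2.lift_mk, Pi.add_apply, Pi.smul_apply, smul_eq_mul]
    have h3 : ∀ (A B C : Fin ν → ℝ) (w u v : ℝ),
        w * ∑ a, A a + u * (w * ∑ a, B a) + v * (w * ∑ a, C a) =
          ∑ a, (w * A a + u * (w * B a) + v * (w * C a)) := by
      intro A B C w u v
      rw [Finset.mul_sum, Finset.mul_sum, Finset.mul_sum, Finset.mul_sum, Finset.mul_sum,
        ← Finset.sum_add_distrib, ← Finset.sum_add_distrib]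
    rw [h3, Finset.mul_sum]
    exact Finset.sum_congr rfl fun a _ => by ring

/-- The weighted bond form is symmetric. [cite: FriedliVelenik2017, §10.5.3, eq. (10.47)] -/
theorem wvecGradForm_comm (f g : V → Fin ν → ℝ) :
    wvecGradForm G W f g = wvecGradForm G W g f := by
  unfold wvecGradForm
  refine Finset.sum_congr rfl fun e _ => ?_
  induction e using Sym2.ind with
  | _ x y =>
    simp only [Sym2.lift_mk]
    exact congrArg _ (Finset.sum_congr rfl fun a _ => by ring)

/-- The weighted quadratic form is nonnegative for nonnegative weights. [cite: FriedliVelenik2017, §10.5.3, eq. (10.47)] -/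
theorem wvecGradForm_self_nonneg (hW : ∀ e, 0 ≤ W e) (f : V → Fin ν → ℝ) :
    0 ≤ wvecGradForm G W f f := by
  unfold wvecGradForm
  refine Finset.sum_nonneg fun e _ => mul_nonneg (hW e) ?_
  induction e using Sym2.ind with
  | _ x y =>
    simp only [Sym2.lift_mk]
    exact Finset.sum_nonneg fun a _ => by nlinarith [sq_nonneg (f x a - f y a)]

/-- The weighted bond form is continuous in its first argument. [cite: FriedliVelenik2017, §10.5.3, eq. (10.47)] -/
theorem continuous_wvecGradForm_left (g : V → Fin ν → ℝ) :
    Continuous fun f : V → Fin ν → ℝ => wvecGradForm G W f g := by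
  unfold wvecGradForm
  refine continuous_finsetSum _ fun e _ => ?_
  induction e using Sym2.ind with
  | _ x y => simp only [Sym2.lift_mk]; fun_prop

/-- The weighted quadratic form is continuous. [cite: FriedliVelenik2017, §10.5.3, eq. (10.47)] -/
theorem continuous_wvecGradForm_self :
    Continuous fun f : V → Fin ν → ℝ => wvecGradForm G W f f := by
  unfold wvecGradForm
  refine continuous_finsetSum _ fun e _ => ?_
  induction e using Sym2.ind with
  | _ x y => simp only [Sym2.lift_mk]; fun_prop

variable (G W) (ρ : Measure (Fin ν → ℝ))

/-- **The functional `Z_W(h)` of Gaussian domination with bond weights**: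
`Z_W(h) = ∫ exp{-∑_{{x,y} ∈ E} W_{x,y}‖ω_x - ω_y + h_x - h_y‖₂²} dμ₀(ω)`, `μ₀ = ⊗_{x ∈ V} ρ`
(Friedli–Velenik 2017, §10.5.3, display before Prop. 10.27, with the coupling absorbed in `W`;
Fröhlich–Israel–Lieb–Simon 1978, Thm. 4.6, `Z(h_α)`). [cite: FILS1978, §4, Thm. 4.6] -/
def wvZ (h : V → Fin ν → ℝ) : ℝ :=
  ∫ ω, Real.exp (-wvecGradForm G W (ω + h) (ω + h)) ∂(Measure.pi fun _ : V => ρ)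

variable {G W ρ}

/-- The integrand of `Z_W(h)` is continuous. [cite: FriedliVelenik2017, §10.5.3, display before Prop. 10.27] -/
theorem continuous_wvZ_integrand (h : V → Fin ν → ℝ) :
    Continuous fun ω : V → Fin ν → ℝ => Real.exp (-wvecGradForm G W (ω + h) (ω + h)) :=
  ((continuous_wvecGradForm_self (G := G) (W := W)).comp
    (continuous_id.add continuous_const)).neg.rexp

/-- The integrand of `Z_W(h)` is at most `1` for nonnegative weights. [cite: FriedliVelenik2017, §10.5.3, display before Prop. 10.27] -/
theorem wvZ_integrand_le_one (hW : ∀ e, 0 ≤ W e) (h ω : V → Fin ν → ℝ) :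
    Real.exp (-wvecGradForm G W (ω + h) (ω + h)) ≤ 1 := by
  rw [Real.exp_le_one_iff, neg_nonpos]
  exact wvecGradForm_self_nonneg hW _

/-- The integrand of `Z_W(h)` is integrable (`W ≥ 0`, `ρ` finite). [cite: FriedliVelenik2017, §10.5.3, display before Prop. 10.27 (well-definedness of Z(h))] -/
theorem integrable_wvZ_integrand [IsFiniteMeasure ρ] (hW : ∀ e, 0 ≤ W e) (h : V → Fin ν → ℝ) :
    Integrable (fun ω : V → Fin ν → ℝ => Real.exp (-wvecGradForm G W (ω + h) (ω + h)))
      (Measure.pi fun _ : V => ρ) := by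
  refine (integrable_const (1 : ℝ)).mono' (continuous_wvZ_integrand h).aestronglyMeasurable
    (ae_of_all _ fun ω => ?_)
  rw [Real.norm_eq_abs, abs_of_pos (Real.exp_pos _)]
  exact wvZ_integrand_le_one hW h ω

/-- `Z_W(h) > 0` (`W ≥ 0`, `ρ` finite and nonzero). [cite: FriedliVelenik2017, §10.5.3, display before Prop. 10.27] -/
theorem wvZ_pos [IsFiniteMeasure ρ] (hρ : ρ ≠ 0) (hW : ∀ e, 0 ≤ W e) (h : V → Fin ν → ℝ) :
    0 < wvZ G W ρ h := by
  haveI : NeZero (Measure.pi fun _ : V => ρ) := ⟨pi_ne_zero ρ hρ⟩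
  exact integral_exp_pos (integrable_wvZ_integrand hW h)

end WeightedForms

/-! ### Reflections: weighted half exponent, two-half kernel, splitting of `Z_W(h)` -/

section Reflection

variable {V : Type*} [Fintype V] [DecidableEq V] (G : SimpleGraph V) [DecidableRel G.Adj]
  (θ : V ≃ V) (P : Finset V) {ν : ℕ} (W : Sym2 V → ℝ) (c : ℝ)

/-- The weighted half exponent `A` (Friedli–Velenik 2017, proof of Prop. 10.27, with bond weights):
`-[∑_{{x,y} ⊆ 𝕋₊} W_{x,y}‖ω_x - ω_y + g_x - g_y‖² + c∑_{x crossing} ‖ω_x + g_x‖²]`, `c` the common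
weight of the crossing bonds. [cite: FriedliVelenik2017, §10.5.3, proof of Prop. 10.27] -/
def whalfExp (g ω : V → Fin ν → ℝ) : ℝ :=
  -(∑ e ∈ innerEdges G P, W e *
      Sym2.lift ⟨fun x y => ∑ a, (ω x a + g x a - (ω y a + g y a)) ^ 2, fun x y =>
        Finset.sum_congr rfl fun a _ => by ring⟩ e +
    c * ∑ x ∈ crossSites G θ P, ∑ a, (ω x a + g x a) ^ 2)

/-- The weighted two-half kernel
`e^{A_{g₁}(τ)} e^{A_{g₂}(τ')} e^{2c ∑_{x crossing} (τ_x + g₁(x))·(τ'_x + g₂(x))}`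
(Friedli–Velenik 2017, Lemma 10.28 / proof of Prop. 10.27). [cite: FriedliVelenik2017, Lemma 10.28 and proof of Prop. 10.27] -/
def wpairKernel (g₁ g₂ : V → Fin ν → ℝ)
    (z : (↥P → Fin ν → ℝ) × (↥P → Fin ν → ℝ)) : ℝ :=
  Real.exp (whalfExp G θ P W c g₁ (extCfg P z.1)) * Real.exp (whalfExp G θ P W c g₂ (extCfg P z.2)) *
    Real.exp (2 * c * ∑ x ∈ crossSites G θ P, ∑ a,
      (extCfg P z.1 x a + g₁ x a) * (extCfg P z.2 x a + g₂ x a))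

/-- The weighted two-half functional as an integral over pairs of half configurations against
`(⊗_{𝕋₊} ρ) ⊗ (⊗_{𝕋₊} ρ)`. [cite: FriedliVelenik2017, Lemma 10.28 and proof of Prop. 10.27] -/
def wpairInt (ρ : Measure (Fin ν → ℝ)) (g₁ g₂ : V → Fin ν → ℝ) : ℝ :=
  ∫ z, wpairKernel G θ P W c g₁ g₂ z
    ∂((Measure.pi fun _ : ↥P => ρ).prod (Measure.pi fun _ : ↥P => ρ))

variable {G θ P W c}

/-- The weighted half exponent depends on the field and the configuration only through their
values on `𝕋₊`. [cite: FriedliVelenik2017, §10.5.3, proof of Prop. 10.27] -/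
theorem whalfExp_congr {g g' ω ω' : V → Fin ν → ℝ} (hg : ∀ x ∈ P, g x = g' x)
    (hω : ∀ x ∈ P, ω x = ω' x) :
    whalfExp G θ P W c g ω = whalfExp G θ P W c g' ω' := by
  unfold whalfExp
  congr 2
  · refine Finset.sum_congr rfl fun e he => ?_
    have hmem := fun z => mem_of_mem_innerEdges (G := G) (P := P) he (z := z)
    revert hmem
    induction e using Sym2.ind with
    | _ x y =>
      intro hmem
      simp only [Sym2.lift_mk]
      rw [hg x (hmem x (Sym2.mem_mk_left x y)), hg y (hmem y (Sym2.mem_mk_right x y)),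
        hω x (hmem x (Sym2.mem_mk_left x y)), hω y (hmem y (Sym2.mem_mk_right x y))]
  · exact congrArg _ (Finset.sum_congr rfl fun x hx => by
      rw [hg x (mem_of_mem_crossSites hx), hω x (mem_of_mem_crossSites hx)])

/-- The weighted half exponent is nonpositive for `W ≥ 0`, `c ≥ 0`. [cite: FriedliVelenik2017, §10.5.3, proof of Prop. 10.27] -/
theorem whalfExp_nonpos (hW : ∀ e, 0 ≤ W e) (hc : 0 ≤ c) (g ω : V → Fin ν → ℝ) :
    whalfExp G θ P W c g ω ≤ 0 := by
  unfold whalfExp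
  rw [neg_nonpos]
  refine add_nonneg (Finset.sum_nonneg fun e _ => mul_nonneg (hW e) ?_)
    (mul_nonneg hc (Finset.sum_nonneg fun x _ => Finset.sum_nonneg fun a _ => sq_nonneg _))
  induction e using Sym2.ind with
  | _ x y =>
    simp only [Sym2.lift_mk]
    exact Finset.sum_nonneg fun a _ => sq_nonneg _

/-- The weighted half exponent is continuous in the configuration. [cite: FriedliVelenik2017, §10.5.3, proof of Prop. 10.27] -/
theorem continuous_whalfExp (g : V → Fin ν → ℝ) :
    Continuous fun ω : V → Fin ν → ℝ => whalfExp G θ P W c g ω := by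
  unfold whalfExp
  refine (Continuous.add (continuous_finsetSum _ fun e _ => ?_) (by fun_prop)).neg
  induction e using Sym2.ind with
  | _ x y => simp only [Sym2.lift_mk]; fun_prop

/-- `wpairInt` depends on the fields only through their values on `𝕋₊`. [cite: FriedliVelenik2017, §10.5.3, proof of Prop. 10.27] -/
theorem wpairInt_congr (ρ : Measure (Fin ν → ℝ)) {g₁ g₁' g₂ g₂' : V → Fin ν → ℝ}
    (h₁ : ∀ x ∈ P, g₁ x = g₁' x) (h₂ : ∀ x ∈ P, g₂ x = g₂' x) :
    wpairInt G θ P W c ρ g₁ g₂ = wpairInt G θ P W c ρ g₁' g₂' := by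
  unfold wpairInt wpairKernel
  refine integral_congr_ae (ae_of_all _ fun z => ?_)
  simp only
  rw [whalfExp_congr h₁ fun _ _ => rfl, whalfExp_congr h₂ fun _ _ => rfl,
    Finset.sum_congr rfl fun x hx => by
      rw [h₁ x (mem_of_mem_crossSites hx), h₂ x (mem_of_mem_crossSites hx)]]

/-- **The weighted exponent split along a reflection** (Friedli–Velenik 2017, proof of Prop. 10.27,
`-∑W‖ω_i - ω_j + h_i - h_j‖² = A + Θ(B) + 2c∑_{i'} C_{i'}·Θ(D_{i'})`), for a weight invariant under
the reflection and equal to `c` on every crossing bond. [cite: FriedliVelenik2017, §10.5.3, proof of Prop. 10.27] -/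
theorem wexponent_split (hθ : ∀ x, θ (θ x) = x) (hadj : ∀ x y, G.Adj (θ x) (θ y) ↔ G.Adj x y)
    (hP : ∀ x, x ∈ P ↔ θ x ∉ P) (hcross : ∀ x y, x ∈ P → y ∉ P → G.Adj x y → y = θ x)
    (hWθ : ∀ e ∈ G.edgeFinset, W (Sym2.map θ e) = W e)
    (hWc : ∀ x ∈ crossSites G θ P, W s(x, θ x) = c) (g ω : V → Fin ν → ℝ) :
    -wvecGradForm G W (ω + g) (ω + g) =
      whalfExp G θ P W c g ω + whalfExp G θ P W c (g ∘ θ) (ω ∘ θ) +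
        2 * c * ∑ x ∈ crossSites G θ P, ∑ a, (ω x a + g x a) * ((ω ∘ θ) x a + (g ∘ θ) x a) := by
  unfold wvecGradForm
  rw [sum_edgeFinset_reflect_split hθ hadj hP hcross]
  unfold whalfExp
  have hinE : ∀ e ∈ innerEdges G P, e ∈ G.edgeFinset := fun e he => (Finset.mem_filter.1 he).1
  have hin : ∑ e ∈ innerEdges G P, W e * Sym2.lift ⟨fun x y => ∑ a,
      ((ω + g) x a - (ω + g) y a) * ((ω + g) x a - (ω + g) y a), fun x y =>
        Finset.sum_congr rfl fun a _ => by ring⟩ e =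
      ∑ e ∈ innerEdges G P, W e * Sym2.lift ⟨fun x y => ∑ a, (ω x a + g x a - (ω y a + g y a)) ^ 2,
        fun x y => Finset.sum_congr rfl fun a _ => by ring⟩ e := by
    refine Finset.sum_congr rfl fun e _ => ?_
    induction e using Sym2.ind with
    | _ x y =>
      simp only [Sym2.lift_mk, Pi.add_apply]
      exact congrArg _ (Finset.sum_congr rfl fun a _ => by ring)
  have hout : ∑ e ∈ innerEdges G P, W (Sym2.map θ e) * Sym2.lift ⟨fun x y => ∑ a,
      ((ω + g) x a - (ω + g) y a) * ((ω + g) x a - (ω + g) y a), fun x y =>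
        Finset.sum_congr rfl fun a _ => by ring⟩ (Sym2.map θ e) =
      ∑ e ∈ innerEdges G P, W e * Sym2.lift ⟨fun x y => ∑ a,
        ((ω ∘ θ) x a + (g ∘ θ) x a - ((ω ∘ θ) y a + (g ∘ θ) y a)) ^ 2,
          fun x y => Finset.sum_congr rfl fun a _ => by ring⟩ e := by
    refine Finset.sum_congr rfl fun e he => ?_
    rw [hWθ e (hinE e he)]
    induction e using Sym2.ind with
    | _ x y =>
      rw [Sym2.map_mk]
      simp only [Sym2.lift_mk, Pi.add_apply, Function.comp_apply]
      exact congrArg _ (Finset.sum_congr rfl fun a _ => by ring)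
  have hcr : ∑ x ∈ crossSites G θ P, W s(x, θ x) * Sym2.lift ⟨fun x y => ∑ a,
      ((ω + g) x a - (ω + g) y a) * ((ω + g) x a - (ω + g) y a), fun x y =>
        Finset.sum_congr rfl fun a _ => by ring⟩ s(x, θ x) =
      c * ∑ x ∈ crossSites G θ P, ∑ a, (ω x a + g x a) ^ 2 +
        c * ∑ x ∈ crossSites G θ P, ∑ a, ((ω ∘ θ) x a + (g ∘ θ) x a) ^ 2 -
          2 * c * ∑ x ∈ crossSites G θ P, ∑ a, (ω x a + g x a) * ((ω ∘ θ) x a + (g ∘ θ) x a) := by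
    rw [Finset.mul_sum, Finset.mul_sum, Finset.mul_sum, ← Finset.sum_add_distrib,
      ← Finset.sum_sub_distrib]
    refine Finset.sum_congr rfl fun x hx => ?_
    rw [hWc x hx]
    simp only [Sym2.lift_mk, Pi.add_apply, Function.comp_apply]
    rw [Finset.mul_sum, Finset.mul_sum, Finset.mul_sum, Finset.mul_sum, ← Finset.sum_add_distrib,
      ← Finset.sum_sub_distrib]
    exact Finset.sum_congr rfl fun a _ => by ring
  rw [hin, hout, hcr]
  ring

/-- The integrand of `Z_W(h)` is the weighted two-half kernel at the split configuration
`(ω|_{𝕋₊}, (ω ∘ θ)|_{𝕋₊})`. [cite: FriedliVelenik2017, §10.5.3, proof of Prop. 10.27] -/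
theorem exp_neg_wvecGradForm_eq_wpairKernel (hθ : ∀ x, θ (θ x) = x)
    (hadj : ∀ x y, G.Adj (θ x) (θ y) ↔ G.Adj x y) (hP : ∀ x, x ∈ P ↔ θ x ∉ P)
    (hcross : ∀ x y, x ∈ P → y ∉ P → G.Adj x y → y = θ x)
    (hWθ : ∀ e ∈ G.edgeFinset, W (Sym2.map θ e) = W e)
    (hWc : ∀ x ∈ crossSites G θ P, W s(x, θ x) = c) (g ω : V → Fin ν → ℝ) :
    Real.exp (-wvecGradForm G W (ω + g) (ω + g)) =
      wpairKernel G θ P W c g (g ∘ θ) (fun x => ω x, fun x => ω (θ x)) := by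
  rw [wexponent_split hθ hadj hP hcross hWθ hWc, Real.exp_add, Real.exp_add, wpairKernel]
  have h1 : ∀ x ∈ P, ω x = extCfg P (fun x : ↥P => ω x) x := fun x hx => by
    rw [extCfg_apply_of_mem _ hx]
  have h2 : ∀ x ∈ P, (ω ∘ θ) x = extCfg P (fun x : ↥P => ω (θ x)) x := fun x hx => by
    rw [extCfg_apply_of_mem _ hx, Function.comp_apply]
  rw [whalfExp_congr (fun _ _ => rfl) h1, whalfExp_congr (fun _ _ => rfl) h2]
  congr 3
  refine Finset.sum_congr rfl fun x hx => Finset.sum_congr rfl fun a _ => ?_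
  rw [h1 x (mem_of_mem_crossSites hx), h2 x (mem_of_mem_crossSites hx)]

/-- **`Z_W(h) = wpairInt(h, h ∘ θ)`** in two-half form (Friedli–Velenik 2017, proof of Prop. 10.27,
the tree's `measurePreserving_splitEquiv`). [cite: FriedliVelenik2017, §10.5.3, proof of Prop. 10.27] -/
theorem wvZ_eq_wpairInt (hθ : ∀ x, θ (θ x) = x) (hadj : ∀ x y, G.Adj (θ x) (θ y) ↔ G.Adj x y)
    (hP : ∀ x, x ∈ P ↔ θ x ∉ P) (hcross : ∀ x y, x ∈ P → y ∉ P → G.Adj x y → y = θ x)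
    (hWθ : ∀ e ∈ G.edgeFinset, W (Sym2.map θ e) = W e)
    (hWc : ∀ x ∈ crossSites G θ P, W s(x, θ x) = c)
    (ρ : Measure (Fin ν → ℝ)) [SigmaFinite ρ] (g : V → Fin ν → ℝ) :
    wvZ G W ρ g = wpairInt G θ P W c ρ g (g ∘ θ) := by
  unfold wvZ wpairInt
  rw [← (measurePreserving_splitEquiv hθ hP ρ).integral_comp']
  refine integral_congr_ae (ae_of_all _ fun ω => ?_)
  simp only
  rw [exp_neg_wvecGradForm_eq_wpairKernel hθ hadj hP hcross hWθ hWc, splitEquiv_apply]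

/-- **Lemma 10.28 for the weighted two-half functional**:
`wpairInt(g₁,g₂)² ≤ wpairInt(g₁,g₁) wpairInt(g₂,g₂)` for `W ≥ 0`, `c ≥ 0` and a finite compactly
supported single-spin measure (the tree's `kerInt_sq_le` with parameter `2c`).
[cite: FriedliVelenik2017, Lemma 10.28] -/
theorem wpairInt_sq_le (ρ : Measure (Fin ν → ℝ)) [IsFiniteMeasure ρ] {K : Set (Fin ν → ℝ)}
    (hKc : IsCompact K) (hK : ρ Kᶜ = 0) (hW : ∀ e, 0 ≤ W e) (hc : 0 ≤ c)
    (g₁ g₂ : V → Fin ν → ℝ) :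
    wpairInt G θ P W c ρ g₁ g₂ ^ 2 ≤ wpairInt G θ P W c ρ g₁ g₁ * wpairInt G θ P W c ρ g₂ g₂ := by
  set m : Measure (↥P → Fin ν → ℝ) := Measure.pi fun _ : ↥P => ρ with hm
  set Φ : (↥P → Fin ν → ℝ) → ℝ := fun τ => Real.exp (whalfExp G θ P W c g₁ (extCfg P τ)) with hΦ
  set Ψ : (↥P → Fin ν → ℝ) → ℝ := fun τ => Real.exp (whalfExp G θ P W c g₂ (extCfg P τ)) with hΨ
  set p : ↥(crossSites G θ P) × Fin ν → (↥P → Fin ν → ℝ) → ℝ :=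
    fun c' τ => extCfg P τ c'.1 c'.2 + g₁ c'.1 c'.2 with hp
  set q : ↥(crossSites G θ P) × Fin ν → (↥P → Fin ν → ℝ) → ℝ :=
    fun c' τ => extCfg P τ c'.1 c'.2 + g₂ c'.1 c'.2 with hq
  have hker : ∀ (F₁ F₂ : (↥P → Fin ν → ℝ) → ℝ) (f₁ f₂ : V → Fin ν → ℝ),
      kerInt m (2 * c) F₁ F₂
        (fun (c' : ↥(crossSites G θ P) × Fin ν) τ => extCfg P τ c'.1 c'.2 + f₁ c'.1 c'.2)
        (fun (c' : ↥(crossSites G θ P) × Fin ν) τ => extCfg P τ c'.1 c'.2 + f₂ c'.1 c'.2) =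
      ∫ z, F₁ z.1 * F₂ z.2 * Real.exp (2 * c * ∑ x ∈ crossSites G θ P, ∑ a,
        (extCfg P z.1 x a + f₁ x a) * (extCfg P z.2 x a + f₂ x a)) ∂(m.prod m) := by
    intro F₁ F₂ f₁ f₂
    unfold kerInt
    refine integral_congr_ae (ae_of_all _ fun z => ?_)
    simp only
    rw [Fintype.sum_prod_type, Finset.sum_coe_sort (crossSites G θ P)
      (fun x => ∑ a, (extCfg P z.1 x a + f₁ x a) * (extCfg P z.2 x a + f₂ x a))]
  have e12 : wpairInt G θ P W c ρ g₁ g₂ = kerInt m (2 * c) Φ Ψ p q := by rw [hker]; rfl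
  have e11 : wpairInt G θ P W c ρ g₁ g₁ = kerInt m (2 * c) Φ Φ p p := by rw [hker]; rfl
  have e22 : wpairInt G θ P W c ρ g₂ g₂ = kerInt m (2 * c) Ψ Ψ q q := by rw [hker]; rfl
  rw [e12, e11, e22]
  obtain ⟨RK, hRK0, hRK⟩ := exists_abs_apply_le_of_isCompact hKc
  set Rg : ℝ := ∑ y, ∑ b, |g₁ y b| + ∑ y, ∑ b, |g₂ y b| with hRg
  have hRg0 : 0 ≤ Rg := add_nonneg (Finset.sum_nonneg fun _ _ => Finset.sum_nonneg fun _ _ =>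
    abs_nonneg _) (Finset.sum_nonneg fun _ _ => Finset.sum_nonneg fun _ _ => abs_nonneg _)
  set R : ℝ := max 1 (RK + Rg) with hR
  have hR0 : 0 ≤ R := le_trans zero_le_one (le_max_left _ _)
  have hΦb : ∀ (f : V → Fin ν → ℝ), ∀ᵐ τ ∂m,
      |Real.exp (whalfExp G θ P W c f (extCfg P τ))| ≤ R := by
    intro f
    refine ae_of_all _ fun τ => ?_
    rw [abs_of_pos (Real.exp_pos _)]
    exact (Real.exp_le_one_iff.2 (whalfExp_nonpos hW hc _ _)).trans (le_max_left _ _)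
  have hmem := ae_pi_forall_mem (ι := ↥P) ρ hK
  have hpb : ∀ (f : V → Fin ν → ℝ), (∀ y b, |f y b| ≤ Rg) →
      ∀ᵐ τ ∂m, ∀ c' : ↥(crossSites G θ P) × Fin ν, |extCfg P τ c'.1 c'.2 + f c'.1 c'.2| ≤ R := by
    intro f hf
    filter_upwards [hmem] with τ hτ c'
    have hx : (c'.1 : V) ∈ P := mem_of_mem_crossSites c'.1.2
    rw [extCfg_apply_of_mem _ hx]
    calc |τ ⟨c'.1, hx⟩ c'.2 + f c'.1 c'.2| ≤ |τ ⟨c'.1, hx⟩ c'.2| + |f c'.1 c'.2| := abs_add_le _ _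
      _ ≤ RK + Rg := add_le_add (hRK _ (hτ _) _) (hf _ _)
      _ ≤ R := le_max_right _ _
  have hg₁ : ∀ y b, |g₁ y b| ≤ Rg := fun y b =>
    (abs_apply_le_sum_abs g₁ y b).trans (le_add_of_nonneg_right
      (Finset.sum_nonneg fun _ _ => Finset.sum_nonneg fun _ _ => abs_nonneg _))
  have hg₂ : ∀ y b, |g₂ y b| ≤ Rg := fun y b =>
    (abs_apply_le_sum_abs g₂ y b).trans (le_add_of_nonneg_left
      (Finset.sum_nonneg fun _ _ => Finset.sum_nonneg fun _ _ => abs_nonneg _))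
  have hΦm : ∀ f : V → Fin ν → ℝ, Measurable fun τ : ↥P → Fin ν → ℝ =>
      Real.exp (whalfExp G θ P W c f (extCfg P τ)) := fun f =>
    (Real.continuous_exp.comp ((continuous_whalfExp f).comp continuous_extCfg)).measurable
  have hpm : ∀ (f : V → Fin ν → ℝ) (c' : ↥(crossSites G θ P) × Fin ν),
      Measurable fun τ : ↥P → Fin ν → ℝ => extCfg P τ c'.1 c'.2 + f c'.1 c'.2 := fun f c' =>
    (((continuous_apply c'.2).comp ((continuous_apply (c'.1 : V)).comp
      continuous_extCfg)).add continuous_const).measurable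
  exact kerInt_sq_le (mul_nonneg zero_le_two hc) (hΦm g₁) (hΦm g₂) (hpm g₁) (hpm g₂) hR0
    (hΦb g₁) (hΦb g₂) (hpb g₁ hg₁) (hpb g₂ hg₂)

/-- **`Z_W(h)² ≤ Z_W(h⁺) Z_W(h⁻)`** (Friedli–Velenik 2017, proof of Prop. 10.27; Fröhlich–Israel–
Lieb–Simon 1978, Thm. 2.3 as used in §4) for a reflection of a finite graph under which the bond
weight is invariant and constant `= c ≥ 0` on the crossing bonds, `W ≥ 0`, and a finite compactly
supported single-spin measure. [cite: FILS1978, §4 (proof of Thm. 4.7 via Thm. 2.3)] -/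
theorem wvZ_sq_le_reflect (hθ : ∀ x, θ (θ x) = x) (hadj : ∀ x y, G.Adj (θ x) (θ y) ↔ G.Adj x y)
    (hP : ∀ x, x ∈ P ↔ θ x ∉ P) (hcross : ∀ x y, x ∈ P → y ∉ P → G.Adj x y → y = θ x)
    (hWθ : ∀ e ∈ G.edgeFinset, W (Sym2.map θ e) = W e)
    (hWc : ∀ x ∈ crossSites G θ P, W s(x, θ x) = c) (hW : ∀ e, 0 ≤ W e) (hc : 0 ≤ c)
    (ρ : Measure (Fin ν → ℝ)) [IsFiniteMeasure ρ] {K : Set (Fin ν → ℝ)} (hKc : IsCompact K)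
    (hK : ρ Kᶜ = 0) (h : V → Fin ν → ℝ) :
    wvZ G W ρ h ^ 2 ≤ wvZ G W ρ (reflPlus θ P h) * wvZ G W ρ (reflMinus θ P h) := by
  rw [wvZ_eq_wpairInt hθ hadj hP hcross hWθ hWc ρ h,
    wvZ_eq_wpairInt hθ hadj hP hcross hWθ hWc ρ (reflPlus θ P h),
    wvZ_eq_wpairInt hθ hadj hP hcross hWθ hWc ρ (reflMinus θ P h)]
  have hplus : wpairInt G θ P W c ρ (reflPlus θ P h) (reflPlus θ P h ∘ θ) =
      wpairInt G θ P W c ρ h h := by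
    refine wpairInt_congr ρ (fun x hx => by simp [reflPlus, hx]) (fun x hx => ?_)
    have hθx : θ x ∉ P := (hP x).1 hx
    simp [reflPlus, hθx, hθ]
  have hminus : wpairInt G θ P W c ρ (reflMinus θ P h) (reflMinus θ P h ∘ θ) =
      wpairInt G θ P W c ρ (h ∘ θ) (h ∘ θ) := by
    refine wpairInt_congr ρ (fun x hx => by simp [reflMinus, hx]) (fun x hx => ?_)
    have hθx : θ x ∉ P := (hP x).1 hx
    simp [reflMinus, hθx]
  rw [hplus, hminus]
  exact wpairInt_sq_le ρ hKc hK hW hc h (h ∘ θ)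

end Reflection

/-! ### A field without bad bonds does not change `Z_W` -/

section Descent

variable {V : Type*} [Fintype V] {G : SimpleGraph V} [DecidableRel G.Adj] {ν : ℕ}
  {W : Sym2 V → ℝ}

/-- `N(g) = 0 ⇒ Z_W(g) = Z_W(0)` (Friedli–Velenik 2017, proof of Prop. 10.27). [cite: FriedliVelenik2017, §10.5.3, proof of Prop. 10.27] -/
theorem wvZ_eq_wvZ_zero_of_vbadBonds_eq_zero (ρ : Measure (Fin ν → ℝ)) {g : V → Fin ν → ℝ}
    (hg : vbadBonds G g = 0) : wvZ G W ρ g = wvZ G W ρ 0 := by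
  unfold wvZ
  refine integral_congr_ae (ae_of_all _ fun ω => ?_)
  simp only
  congr 2
  unfold wvecGradForm
  refine Finset.sum_congr rfl fun e he => ?_
  have hterm := (Finset.sum_eq_zero_iff.1 hg) e he
  induction e using Sym2.ind with
  | _ x y =>
    rw [vbadInd_mk] at hterm
    have hxy : g x = g y := by
      by_contra h
      rw [if_neg h] at hterm
      exact one_ne_zero hterm
    simp only [Sym2.lift_mk, Pi.add_apply, Pi.zero_apply, add_zero, hxy]
    exact congrArg _ (Finset.sum_congr rfl fun a _ => by ring)

end Descent

/-! ### The torus with direction-dependent couplings: `bondWeight K` and Gaussian domination -/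

section Torus

variable {d L : ℕ} {ν : ℕ}

/-- **Direction-dependent nearest-neighbour couplings on the torus** as a bond weight:
`W_{x,y} = K_i` if `y = x ± eᵢ` (and `0` on non-bonds) — the couplings `J_{αγ}` of the
anisotropic nearest-neighbour model of Fröhlich–Israel–Lieb–Simon 1978, §4 (Kennedy–Lieb–Shastry's
`(1, 1, r)` for the layered case). [cite: FILS1978, §4, Thm. 4.6–4.7 (nearest-neighbour `J_{αγ}`)] -/
def bondWeight (K : Fin d → ℝ) : Sym2 (TorusSite d L) → ℝ :=
  Sym2.lift ⟨fun x y => ∑ i, if y = x + Pi.single i 1 ∨ x = y + Pi.single i 1 then K i else 0,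
    fun _ _ => Finset.sum_congr rfl fun _ _ => if_congr or_comm rfl rfl⟩

/-- The bond weight is nonnegative for nonnegative couplings. [cite: FILS1978, §4, Thm. 4.6 (nearest-neighbour couplings J ≥ 0)] -/
theorem bondWeight_nonneg {K : Fin d → ℝ} (hK : ∀ i, 0 ≤ K i) (e : Sym2 (TorusSite d L)) :
    0 ≤ bondWeight K e := by
  induction e using Sym2.ind with
  | _ x y =>
    simp only [bondWeight, Sym2.lift_mk]
    exact Finset.sum_nonneg fun i _ => by split_ifs <;> simp [hK i]

/-- **The weight of the bond `{x, x + eᵢ}` is `K_i`** (`L ≥ 3`, so that the direction of a torus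
bond is well defined). [cite: FILS1978, §4, Thm. 4.6 (nearest-neighbour couplings)] -/
theorem bondWeight_mk_add_single [NeZero L] (hL : 3 ≤ L) (K : Fin d → ℝ) (x : TorusSite d L) (i : Fin d) :
    bondWeight K s(x, x + Pi.single i 1) = K i := by
  have hL2 : 2 ≤ L := by omega
  simp only [bondWeight, Sym2.lift_mk]
  rw [Finset.sum_eq_single i (fun j _ hj => ?_) (fun hi => absurd (Finset.mem_univ i) hi)]
  · simp
  · rw [if_neg]
    push Not
    constructor
    · intro h
      exact hj (torus_single_injective hL2 (add_left_cancel h)).symm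
    · intro h
      have h2 : (Pi.single i 1 : TorusSite d L) + Pi.single j 1 = 0 := by
        have h3 := congr_arg (· - x) h
        simpa [add_assoc] using h3.symm
      exact torus_single_add_single_ne_zero hL i j h2

/-- Every edge of the torus graph is `{x, x + eᵢ}` for some site `x` and direction `i`. [cite: FriedliVelenik2017, §10.5.3 (the edge set 𝓔_L of the torus)] -/
theorem exists_eq_mk_add_single_of_mem_edgeFinset [NeZero L] {e : Sym2 (TorusSite d L)}
    (he : e ∈ (torusGraph d L).edgeFinset) :
    ∃ (x : TorusSite d L) (i : Fin d), e = s(x, x + Pi.single i 1) := by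
  induction e using Sym2.ind with
  | _ a b =>
    have hab : (torusGraph d L).Adj a b := SimpleGraph.mem_edgeFinset.1 he
    rw [torusGraph_adj_iff] at hab
    rcases hab.2 with ⟨i, rfl⟩ | ⟨i, rfl⟩
    · exact ⟨a, i, rfl⟩
    · exact ⟨b, i, Sym2.eq_swap⟩

/-- **The reflection between sites preserves the direction-dependent bond weight**: it maps a
direction-`j` bond to a direction-`j` bond (parallel bonds are translated, bonds across the mirror
are reversed). [cite: FILS1978, §3 (reflections in planes perpendicular to a lattice axis)] -/
theorem bondWeight_map_reflectBetweenSites [NeZero L] (hL : 3 ≤ L) (K : Fin d → ℝ) (i : Fin d) (k : ZMod L)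
    {e : Sym2 (TorusSite d L)} (he : e ∈ (torusGraph d L).edgeFinset) :
    bondWeight K (Sym2.map (Torus.reflectBetweenSites i k) e) = bondWeight K e := by
  obtain ⟨x, j, rfl⟩ := exists_eq_mk_add_single_of_mem_edgeFinset he
  rw [Sym2.map_mk, bondWeight_mk_add_single hL]
  by_cases hj : j = i
  · subst hj
    -- across the mirror: `θ x = θ (x + e_j) + e_j`
    rw [Torus.reflectBetweenSites_eq_add_single j k x, Sym2.eq_swap, bondWeight_mk_add_single hL]
  · rw [Torus.reflectBetweenSites_add_single_of_ne i k x hj, bondWeight_mk_add_single hL]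

/-- **A crossing bond of the reflection perpendicular to axis `i` is a direction-`i` bond**, so its
weight is `K_i`: if `x ∼ θx` for `θ` the reflection between sites perpendicular to axis `i`, then
`θ x = x ± eᵢ`. [cite: FILS1978, §3 (reflections in planes perpendicular to a lattice axis)] -/
theorem bondWeight_cross [NeZero L] (hL : 3 ≤ L) (K : Fin d → ℝ) (i : Fin d) (k : ZMod L)
    {x : TorusSite d L} (hx : (torusGraph d L).Adj x (Torus.reflectBetweenSites i k x)) :
    bondWeight K s(x, Torus.reflectBetweenSites i k x) = K i := by
  have hL2 : 2 ≤ L := by omega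
  set θ := Torus.reflectBetweenSites (d := d) (L := L) i k with hθ
  rw [torusGraph_adj_iff] at hx
  obtain ⟨-, h⟩ := hx
  -- the direction `j` of the bond must be `i`: the reflection fixes every other coordinate
  have hdir : ∀ j : Fin d, (θ x = x + Pi.single j 1 ∨ x = θ x + Pi.single j 1) → j = i := by
    intro j hj
    by_contra hji
    have hfix : θ x j = x j := Torus.reflectBetweenSites_apply_of_ne i k x hji
    have hone : (1 : ZMod L) = 0 := by
      rcases hj with h1 | h1
      · have := congr_fun h1 j
        rw [hfix, Pi.add_apply, Pi.single_eq_same] at this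
        simpa using this
      · have := congr_fun h1 j
        rw [Pi.add_apply, hfix, Pi.single_eq_same] at this
        simpa using this.symm
    exact torus_single_ne_zero (d := d) hL2 j (by
      funext l; by_cases hl : l = j
      · subst hl; simp [hone]
      · simp [hl])
  rcases h with ⟨j, hj⟩ | ⟨j, hj⟩
  · have := hdir j (Or.inl hj); subst this
    rw [hj, bondWeight_mk_add_single hL]
  · have := hdir j (Or.inr hj); subst this
    rw [show s(x, θ x) = s(θ x, θ x + Pi.single j 1) by rw [← hj, Sym2.eq_swap],
      bondWeight_mk_add_single hL]

/-- **Gaussian domination on the even torus with direction-dependent couplings**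
(Fröhlich–Israel–Lieb–Simon 1978, Thm. 4.6–4.7: "the Gaussian domination estimate `Z(h_α) ≤ Z(0)`
holds for arbitrary `dρ`"; Friedli–Velenik 2017, Prop. 10.27 for the isotropic case): for
`ν`-component spins with a finite, nonzero, compactly supported single-spin measure, `L` even,
`L ≥ 4`, and couplings `K_i ≥ 0` per lattice direction, `Z_K(h) ≤ Z_K(0)` for every field `h`.
Proof: the printed descent on the number of bad bonds — a maximiser of `Z_K` (over the finite set of
fields with values in the range of `h`, Kennedy–Lieb–Shastry's finite descent) with fewest bad bonds
has none, since a bad bond `{x, x + eᵢ}` is bisected by the reflection between sites perpendicular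
to axis `i`, which preserves `bondWeight K` and whose crossing bonds all carry the weight `K_i`, so
that `Z_K(g)² ≤ Z_K(g⁺)Z_K(g⁻)` (`wvZ_sq_le_reflect`) while `N(g⁺) + N(g⁻) ≤ 2N(g) - 2`.
[cite: FILS1978, §4, Thm. 4.6–4.7] -/
theorem wvZ_le_wvZ_zero [NeZero L] (hL : Even L) (hL4 : 4 ≤ L) (ρ : Measure (Fin ν → ℝ)) [IsFiniteMeasure ρ]
    {S : Set (Fin ν → ℝ)} (hSc : IsCompact S) (hS : ρ Sᶜ = 0) (hρ : ρ ≠ 0) {K : Fin d → ℝ}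
    (hK : ∀ i, 0 ≤ K i) (h : TorusSite d L → Fin ν → ℝ) :
    wvZ (torusGraph d L) (bondWeight K) ρ h ≤ wvZ (torusGraph d L) (bondWeight K) ρ 0 := by
  classical
  set Gr := torusGraph d L
  set W : Sym2 (TorusSite d L) → ℝ := bondWeight K with hWdef
  have hW : ∀ e, 0 ≤ W e := bondWeight_nonneg hK
  have hL3 : 3 ≤ L := by omega
  set R : Finset (Fin ν → ℝ) := Finset.univ.image h with hR
  set F : Finset (TorusSite d L → Fin ν → ℝ) := Fintype.piFinset fun _ => R with hF
  have hhF : h ∈ F := by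
    rw [hF, Fintype.mem_piFinset]
    intro x
    exact Finset.mem_image_of_mem h (Finset.mem_univ x)
  have hFne : F.Nonempty := ⟨h, hhF⟩
  obtain ⟨g₀, hg₀F, hg₀max⟩ := Finset.exists_max_image F (wvZ Gr W ρ) hFne
  set Fmax := F.filter fun g => wvZ Gr W ρ g = wvZ Gr W ρ g₀ with hFmax
  have hFmaxne : Fmax.Nonempty := ⟨g₀, by simp [hFmax, hg₀F]⟩
  obtain ⟨g, hgFmax, hgmin⟩ := Finset.exists_min_image Fmax (vbadBonds Gr) hFmaxne
  obtain ⟨hgF, hgZ⟩ := Finset.mem_filter.1 hgFmax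
  have hgmax : ∀ g' ∈ F, wvZ Gr W ρ g' ≤ wvZ Gr W ρ g := fun g' hg' => hgZ ▸ hg₀max g' hg'
  have hN : vbadBonds Gr g = 0 := by
    by_contra hN0
    obtain ⟨e, he, hbad⟩ : ∃ e ∈ Gr.edgeFinset, vbadInd g e ≠ 0 := by
      by_contra hall
      push Not at hall
      exact hN0 (Finset.sum_eq_zero hall)
    obtain ⟨x, i, hxy⟩ := exists_eq_mk_add_single_of_mem_edgeFinset he
    subst hxy
    rw [vbadInd_mk] at hbad
    have hgx : g x ≠ g (x + Pi.single i 1) := by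
      intro h'; rw [if_pos h'] at hbad; exact hbad rfl
    set θ := Torus.reflectBetweenSites (d := d) (L := L) i (x i) with hθdef
    set P := (Torus.halfBetweenSites (d := d) (L := L) i (x i)).toFinset with hPdef
    have hθθ : ∀ z, θ (θ z) = z := Torus.reflectBetweenSites_involutive i (x i)
    have hadj : ∀ a b, Gr.Adj (θ a) (θ b) ↔ Gr.Adj a b :=
      Torus.torusGraph_adj_reflectBetweenSites_iff i (x i)
    have hP : ∀ a, a ∈ P ↔ θ a ∉ P :=
      Torus.mem_halfBetweenSites_iff_reflect_not_mem hL i (x i)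
    have hcross : ∀ a b, a ∈ P → b ∉ P → Gr.Adj a b → b = θ a := fun a b ha hb hab =>
      Torus.eq_reflectBetweenSites_of_adj hL hL4 i (x i) ha hb hab
    have hWθ : ∀ e ∈ Gr.edgeFinset, W (Sym2.map θ e) = W e := fun e he =>
      bondWeight_map_reflectBetweenSites hL3 K i (x i) he
    have hWc : ∀ a ∈ crossSites Gr θ P, W s(a, θ a) = K i := fun a ha =>
      bondWeight_cross hL3 K i (x i) (Finset.mem_filter.1 ha).2
    obtain ⟨hyP, hθy⟩ := Torus.add_single_mem_halfBetweenSites (by omega : 2 ≤ L) i x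
    have hsq := wvZ_sq_le_reflect (G := Gr) hθθ hadj hP hcross hWθ hWc hW (hK i) ρ hSc hS g
    have hPF : reflPlus θ P g ∈ F := reflPlus_mem_piFinset hgF
    have hMF : reflMinus θ P g ∈ F := reflMinus_mem_piFinset hgF
    have hPle := hgmax _ hPF
    have hMle := hgmax _ hMF
    have hZpos := wvZ_pos (G := Gr) (W := W) hρ hW g
    have hPpos := wvZ_pos (G := Gr) (W := W) hρ hW (reflPlus θ P g)
    have hMpos := wvZ_pos (G := Gr) (W := W) hρ hW (reflMinus θ P g)
    have hPeq : wvZ Gr W ρ (reflPlus θ P g) = wvZ Gr W ρ g := by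
      refine le_antisymm hPle ?_
      by_contra hlt
      push Not at hlt
      have : wvZ Gr W ρ (reflPlus θ P g) * wvZ Gr W ρ (reflMinus θ P g) <
          wvZ Gr W ρ g * wvZ Gr W ρ g :=
        mul_lt_mul hlt hMle hMpos hZpos.le
      nlinarith
    have hMeq : wvZ Gr W ρ (reflMinus θ P g) = wvZ Gr W ρ g := by
      refine le_antisymm hMle ?_
      by_contra hlt
      push Not at hlt
      have : wvZ Gr W ρ (reflPlus θ P g) * wvZ Gr W ρ (reflMinus θ P g) <
          wvZ Gr W ρ g * wvZ Gr W ρ g :=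
        mul_lt_mul' hPle hlt hMpos.le hZpos
      nlinarith
    have hPmin : vbadBonds Gr g ≤ vbadBonds Gr (reflPlus θ P g) :=
      hgmin _ (Finset.mem_filter.2 ⟨hPF, hPeq.trans hgZ⟩)
    have hMmin : vbadBonds Gr g ≤ vbadBonds Gr (reflMinus θ P g) :=
      hgmin _ (Finset.mem_filter.2 ⟨hMF, hMeq.trans hgZ⟩)
    have hcount := vbadBonds_reflPlus_add_reflMinus (G := Gr) hθθ hadj hP hcross g
    have hycross : x + Pi.single i 1 ∈ crossSites Gr θ P := by
      refine Finset.mem_filter.2 ⟨hyP, ?_⟩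
      rw [hθy]
      exact (torusGraph_adj_add_single (by omega) x i).symm
    have hone : (1 : ℕ) ≤ ∑ z ∈ crossSites Gr θ P, vbadInd g s(z, θ z) := by
      calc (1 : ℕ) = vbadInd g s(x + Pi.single i 1, θ (x + Pi.single i 1)) := by
            rw [vbadInd_mk, hθy, if_neg (Ne.symm hgx)]
        _ ≤ ∑ z ∈ crossSites Gr θ P, vbadInd g s(z, θ z) :=
          Finset.single_le_sum (f := fun z => vbadInd g s(z, θ z)) (fun z _ => Nat.zero_le _)
            hycross
    omega
  calc wvZ Gr W ρ h ≤ wvZ Gr W ρ g := hgmax h hhF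
    _ = wvZ Gr W ρ 0 := wvZ_eq_wvZ_zero_of_vbadBonds_eq_zero ρ hN

end Torus

end NVector

end Literature.Probability.LatticeModels
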